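import Literature.AlgebraicGeometry.Frobenioids.Prop55Sub
import Literature.AlgebraicGeometry.Frobenioids.UnitTrivializationStandardTypeProofs
import Literature.AlgebraicGeometry.Frobenioids.ModelFrobenioidStandardProofs
import HarnessLib

/-!
# Frobenioids I, Proposition 5.5 (iii), "Finally" (standard type) — closers: `C^un-tr` unconditionally,
# `C^rlf` through Theorem 5.2 (iii) at THE realified data

Mochizuki, *The geometry of Frobenioids I: the general theory*, Kyushu J. Math. **62** (2008)
293–400, §5, Proposition 5.5 (iii) p. 104 ll. 37–39 / proof p. 105 ll. 22–27 [cite: MochizukiFrdI2008, Prop. 5.5 (iii) p.104],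
and Theorem 5.2 (iii) p. 101 ("`C` is of standard type if and only if … (a) if `Φ` is the zero monoid, then
`C` admits a Frobenius-compact object; (b) `D` is of FSMFF-type; (c) `Φ` is non-dilating", PROVED for
model Frobenioids: `ModelFrobenioid.standardTypeIff_holds`, seat abc-iut-L1-t2).

Proof-only companion of the statements file `Prop55Sub.lean` (cell abc-iut, sub-DAG S7 row
`FrdI:Prop5.5(iii)/P55-L07`, seat abc-iut-w4-d084):
* `PreFrobenioid.isOfStandardType_rlf_of` — THE realification `C^rlf = rlf F hΦ` (the model Frobenioid of
  `(Φ^rlf, ℝ · Φ^birat)`, structure functor `rlfToElem F hΦ`) is of standard type as soon as the realified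
  data satisfy the standing hypotheses of Thm. 5.2 (`ModelFrobenioid.Hypotheses`: `Φ^rlf` a divisorial
  monoid on `D`, `ℝ · Φ^birat` a group-like monoid on `D`, `D` connected and totally epimorphic), `Φ^rlf`
  is not the zero monoid, `D` is of FSMFF-type and `Φ^rlf` is non-dilating — Thm. 5.2 (iii) read from
  right to left (clause (a) being vacuous);
* `PreFrobenioid.rlfFunctor_apply_ne_one` — `Φ → Φ^rlf` is injective objectwise (`M → M^pf` for a
  divisorial `M`, then the factorization homomorphism), so `Φ^rlf` is not the zero monoid as soon as some
  `Φ(Base A)` is non-trivial, i.e. as soon as `C` is not of group-like type;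
* `FrdI.Prop55Sub.prop55iii_untr_rlf_standard_of` — the named statement `Prop55iii_untr_rlf_standard`
  MODULO the two realification inputs that the tree does not yet carry as theorems (stated as
  hypotheses, NOT as new facts): (H) the Thm. 5.2 hypotheses for THE realified data and (N) "`Φ`
  non-dilating ⇒ `Φ^rlf` non-dilating" (print p. 105 l. 26: "it follows immediately from the definitions");
  the `C^un-tr` conjunct is `isOfStandardType_untr'` (unconditional, `UnitTrivializationStandardTypeProofs.lean`).
No statement of the paper is strengthened; nothing here bears on [IUTchIII] Cor. 3.12.
-/

namespace Literature.AlgebraicGeometry.Frobenioids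

open CategoryTheory Opposite

universe w v v' u u'

namespace PreFrobenioid

variable {D : Type u} [Category.{v} D] {Φ : Dᵒᵖ ⥤ CommMonCat.{w}} {C : Type u'}
  [Category.{v'} C] (F : C ⥤ ElemFrobenioid Φ)

open PreFrobenioidData (ofFunctor)
open Literature.AnabelianGeometry.EtaleTheta (rlfFunctor toRlfNatTrans)

/-- **Thm. 5.2 (iii) at THE realified data, right to left**: if `(Φ^rlf, ℝ · Φ^birat)` satisfy the
standing hypotheses of Thm. 5.2, `Φ^rlf` is not the zero monoid, `D` is of FSMFF-type and `Φ^rlf` is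
non-dilating, then `C^rlf → F_{Φ^rlf}` is of standard type. [cite: MochizukiFrdI2008, Thm. 5.2(iii) p.101] -/
theorem isOfStandardType_rlf_of (hΦ : IsPerfFactorialOn Φ)
    (hH : ModelFrobenioid.Hypotheses (rlfFunctor Φ (IsPerfFactorialOn.op hΦ))
      ((RealificationData.canonical Φ (IsPerfFactorialOn.op hΦ)).realSpan (biratSubfunctor F)).toMonoid)
    (hnz : ¬ ModelFrobenioid.IsZeroMonoid (rlfFunctor Φ (IsPerfFactorialOn.op hΦ)))
    (hD : IsOfFSMFFType D) (hnd : IsNonDilatingOn (rlfFunctor Φ (IsPerfFactorialOn.op hΦ))) :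
    (ofFunctor _ (rlfToElem F hΦ)).IsOfStandardType :=
  (ModelFrobenioid.standardTypeIff_holds _ _ _ hH).mpr ⟨fun h0 => (hnz h0).elim, hD, hnd⟩

/-- `Φ(X) → Φ(X)^rlf` (the component of `Φ ⟶ Φ^rlf`, i.e. `M → M^pf → M^rlf`) is injective for
perf-factorial `Φ(X)`: `M → M^pf` is injective for a divisorial (sharp, integral, saturated) `M` (§0 p. 11)
and `M^pf → M^rlf` is the injective factorization homomorphism of Def. 2.4 (i)(c).
[cite: MochizukiFrdI2008, Def. 2.4(i) p.47] -/
theorem toRlfNatTrans_app_injective (hΦ : ∀ X : Dᵒᵖ, IsPerfFactorial (Φ.obj X)) (X : Dᵒᵖ) :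
    Function.Injective ((toRlfNatTrans Φ hΦ).app X).hom := by
  intro a b hab
  have hd := (hΦ X).isDivisorial
  have h1 : (hΦ X).toRealification (Frobenioids.Perfection.of _ a) =
      (hΦ X).toRealification (Frobenioids.Perfection.of _ b) := hab
  have h2 : factorMap (Φ.obj X) (Frobenioids.Perfection.of _ a) =
      factorMap (Φ.obj X) (Frobenioids.Perfection.of _ b) := congrArg Subtype.val h1
  exact Frobenioids.of_injective_of_isSharp_isIntegral_isSaturated hd.isSharp
    hd.isPreDivisorial.isIntegral hd.isPreDivisorial.isSaturated ((hΦ X).factorMap_injective h2)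

/-- Hence `Φ^rlf` is not the zero monoid as soon as some `Φ(X)` has an element `≠ 1`.
[cite: MochizukiFrdI2008, Def. 2.4(i) p.47] -/
theorem not_isZeroMonoid_rlfFunctor (hΦ : ∀ X : Dᵒᵖ, IsPerfFactorial (Φ.obj X)) {X : Dᵒᵖ}
    {x : Φ.obj X} (hx : x ≠ 1) : ¬ ModelFrobenioid.IsZeroMonoid (rlfFunctor Φ hΦ) := by
  intro h0
  apply hx
  apply toRlfNatTrans_app_injective hΦ X
  rw [map_one]
  exact h0 X _

/-- For a Frobenioid NOT of group-like type, `Φ^rlf` is not the zero monoid (some `Φ(Base A)` has an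
element `≠ 1`, and `Φ → Φ^rlf` is injective). [cite: MochizukiFrdI2008, Prop. 5.5 (iii) p.104] -/
theorem not_isZeroMonoid_rlfFunctor_of_not_groupLike (hΦ : IsPerfFactorialOn Φ)
    (hng : ¬ IsOfType (IsGroupLikeObj F)) :
    ¬ ModelFrobenioid.IsZeroMonoid (rlfFunctor Φ (IsPerfFactorialOn.op hΦ)) := by
  obtain ⟨A, hA⟩ := not_forall.mp hng
  obtain ⟨x, hx⟩ := not_forall.mp hA
  exact not_isZeroMonoid_rlfFunctor (IsPerfFactorialOn.op hΦ) hx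

end PreFrobenioid

namespace FrdI.Prop55Sub

open PreFrobenioid
open PreFrobenioidData (ofFunctor)
open Literature.AnabelianGeometry.EtaleTheta (rlfFunctor)

variable {D : Type u} [Category.{v} D] {Φ : Dᵒᵖ ⥤ CommMonCat.{w}} {C : Type u'}
  [Category.{v'} C] (F : C ⥤ ElemFrobenioid Φ)

/-- **Proposition 5.5 (iii), "Finally", standard type — the named statement
`Prop55iii_untr_rlf_standard` MODULO the two realification inputs**: (H) the standing hypotheses of
Thm. 5.2 for THE realified data `(Φ^rlf, ℝ · Φ^birat)` and (N) "`Φ` non-dilating ⇒ `Φ^rlf` non-dilating"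
(both hypotheses of this theorem, not facts of the tree). The `C^un-tr` conjunct is unconditional
(`isOfStandardType_untr'`); the `C^rlf` conjunct is Thm. 5.2 (iii) at the realified data
(`isOfStandardType_rlf_of`), clause (a) vacuous because `C` is not of group-like type.
[cite: MochizukiFrdI2008, Prop. 5.5 (iii) p.104] -/
theorem prop55iii_untr_rlf_standard_of (hF : IsFrobenioid F) (hΦ : IsPerfFactorialOn Φ)
    (hH : ModelFrobenioid.Hypotheses (rlfFunctor Φ (IsPerfFactorialOn.op hΦ))
      ((RealificationData.canonical Φ (IsPerfFactorialOn.op hΦ)).realSpan (biratSubfunctor F)).toMonoid)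
    (hN : (ofFunctor Φ F).IsNonDilatingOn → IsNonDilatingOn (rlfFunctor Φ (IsPerfFactorialOn.op hΦ))) :
    Prop55iii_untr_rlf_standard F hF hΦ := fun _ _ hng hS =>
  ⟨isOfStandardType_untr' hF hng hS,
    isOfStandardType_rlf_of F hΦ hH (not_isZeroMonoid_rlfFunctor_of_not_groupLike F hΦ hng) hS.fsmff
      (hN hS.nonDilating)⟩

end FrdI.Prop55Sub

end Literature.AlgebraicGeometry.Frobenioids
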